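import Summits.QuantumFields.YangMills.Theorems.SmallFieldWideningLargeFieldMassRefinementTailGaussianRung

/-!
# Route `SmallFieldWidening`, crux r3 `LargeFieldMassRefinementTail` (stmt-QuantumFields-22884), line `birth` v6 — THE MAXWELL RUNG OF `CondStab`: in the
# lattice-Maxwell (abelian, linearised) caricature ONE MORE ULTRAVIOLET LEVEL CAN ONLY RAISE THE LARGE-DEVIATION COST (and lower the variance) OF EVERY
# OBSERVABLE OF THE BLOCK-AVERAGED FIELD — the one-step slack of `CondStab` is `≤ 0` there
# (support file, kernel rung; width seat `ym-line-sfw-p2-w2` gen 17; the stub `stub_firstExitDeep`, the crux and rung R3 stay OPEN)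

WHY.  The companion file `…CondStab` reduces crux r3 to `CondStab`: «run `K+1` versus run `K` of one family at one unit coupling — one more UV level — does not
raise the conditional unit-plaquette tail in the small-field sector by more than `e^{ρ_K}`, `Σρ_K` sub-Gaussian in `p`».  Its Gaussian evidence so far was a table
(kit j291705, cell ym-idea-1 `bc/gauss_kuniform.md`: unit-level variance `0.2541, 0.2153, 0.2110, 0.2105` for `K = 1..4`, decreasing).  THIS FILE makes the sign a
KERNEL THEOREM for Bałaban's (0.4) averaging of record (`AbelianEML.linAvg04` / `linAvgIter`, the tree's typing of [Balaban1987RG1] (0.4)) in every dimension: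

* §1 ★ `energy_curl_linAvgIter_le` — THE ENERGY INEQUALITY (Schur test on the landed weight `SFWGaussianRung.exists_weight`: `V ≥ 0`, row sums `(L²)^s`, column
  sums `≤ (L²/L^d)^s`, plus Cauchy–Schwarz): for every one-form `a` on the finest lattice and every plane `(μ, ν)`,
  `Σ_{y ∈ T^{(s)}} (curl (linAvgIter s a))(y; μ, ν)² ≤ (L²)^s·(L²/L^d)^s · Σ_{p ∈ T^{(0)}} (curl a)(p; μ, ν)²`; in `d = 3` the factor is `L^s = β_K/β_{K−s}`:
  «the coarse Maxwell action of the `s`-fold averaged field at the coarse coupling is at most the fine Maxwell action at the fine coupling»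
  (`maxwell_linAvgIter_le_T3`: `β·Σ(curl Q^s a)² ≤ (βL^s)·Σ(curl a)²`).  `d = 4` is exactly marginal (factor `1`).
* §2 ★★ `ldCost_mono` / `ldCost_mono_T3` — LARGE-DEVIATION COSTS ARE MONOTONE: for ANY set `𝒜` of level-`s` one-forms, if every `b ∈ 𝒜` has coarse action
  `β·Σ(curl b)² ≥ M`, then every fine `a` with `linAvgIter s a ∈ 𝒜` has fine action `(βL^s)·Σ(curl a)² ≥ M` (d = 3) — the Laplace/large-deviation cost of a coarse
  event computed in the theory WITH `s` extra UV levels is at least its cost in the theory without them; and ★★ `dualVariance_mono` — the Legendre-dual form: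
  for ANY functional `g` of the level-`s` field, `sup_a [2g(linAvgIter s a) − (βL^s)Σ(curl a)²] ≤ sup_b [2g(b) − βΣ(curl b)²]`; for linear `g` and the Gaussian
  measures `∝ exp(−½βΣ(curl ·)²)` (lattice Maxwell, any gauge fixing, `g` gauge invariant) these suprema ARE the variances, so
  `Var_{K}(g ∘ Q^s) ≤ Var_{K−s}(g)`: the table's monotonicity in `K`, for every gauge-invariant linear observable and every `d ≤ 4`.
  The one-step forms (`s = 1`, `…_one`) are the caricature of `CondStab`'s `K ↦ K+1` with `ρ_K = 0`: the extra level is the finest one and `g` is arbitrary, so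
  «`K` common averagings above it» need not be spelled out.

WHAT THIS IS NOT.  Abelian and quadratic only: no statement about the interacting `SU(2)` law (whose one-step slack is the content of `CondStab`, OPEN), no
measure is constructed (the Gaussian reading of §2 is the standard Legendre identity `Var = sup(2g − E)`, stated in the docstrings, not used), no conditioning on
the small history (in the Gaussian caricature the history constraints are symmetric convex and only lower tails further, by the Gaussian correlation inequality —
not formalised).  Nothing here bears on the Yang–Mills mass gap; rung R3 is a RECORD rung; crux r3 and `stub_firstExitDeep` stay open.

References: T. Bałaban, Commun. Math. Phys. **109** (1987) 249–301 [Balaban1987RG1] ((0.4), (0.11) p.253); CMP **98** (1985) 17–51 [Balaban1985Averaging] ((9),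
(14) p.19); CMP **102** (1985) 255–275 [Balaban1985UV3] ((1)–(3) p.256: `β_K = L^s β_{K−s}` in d = 3).
-/

set_option autoImplicit false

noncomputable section

namespace Summit.QuantumFields.YangMills.Theorems.LargeFieldMassRefinementTailCondStabMaxwellRung

open scoped BigOperators
open Literature.MathematicalPhysics.QuantumFieldTheory.Balaban1983to89
open Summit.QuantumFields.YangMills.Theorems.AbelianEML
open Summit.QuantumFields.YangMills.Theorems.SFWGaussianRung (exists_weight)

variable {P : Params}

/-! ## §1 The energy inequality: the coarse Maxwell action of the averaged field is at most `(L^{4−d})^s` × the fine one -/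

/-- **SCHUR TEST**: a kernel `V ≥ 0` with row sums `R ≥ 0` and column sums `≤ B` satisfies `Σ_y (Σ_p V y p·F p)² ≤ R·B·Σ_p (F p)²`. [folklore] -/
theorem sum_sq_kernel_le {α β : Type*} [Fintype α] [Fintype β] (V : α → β → ℝ) (F : β → ℝ) {R B : ℝ} (hR : 0 ≤ R)
    (hV0 : ∀ y p, 0 ≤ V y p) (hrow : ∀ y, ∑ p, V y p = R) (hcol : ∀ p, ∑ y, V y p ≤ B) :
    ∑ y, (∑ p, V y p * F p) ^ 2 ≤ R * B * ∑ p, F p ^ 2 := by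
  -- weighted Cauchy–Schwarz `(Σ V F)² ≤ (Σ V)(Σ V F²)` row by row (the tree's `GuthMaynardAffine.sq_sum_mul_le` pattern, inlined)
  have hcs : ∀ y, (∑ p, V y p * F p) ^ 2 ≤ (∑ p, V y p) * ∑ p, V y p * F p ^ 2 := by
    intro y
    have h := Finset.sum_mul_sq_le_sq_mul_sq Finset.univ (fun p => Real.sqrt (V y p)) (fun p => Real.sqrt (V y p) * F p)
    have h1 : ∀ p ∈ (Finset.univ : Finset β), Real.sqrt (V y p) * (Real.sqrt (V y p) * F p) = V y p * F p := fun p _ => by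
      rw [← mul_assoc, Real.mul_self_sqrt (hV0 y p)]
    have h2 : ∀ p ∈ (Finset.univ : Finset β), Real.sqrt (V y p) ^ 2 = V y p := fun p _ => Real.sq_sqrt (hV0 y p)
    have h3 : ∀ p ∈ (Finset.univ : Finset β), (Real.sqrt (V y p) * F p) ^ 2 = V y p * F p ^ 2 := fun p _ => by
      rw [mul_pow, Real.sq_sqrt (hV0 y p)]
    rw [Finset.sum_congr rfl h1, Finset.sum_congr rfl h2, Finset.sum_congr rfl h3] at h
    exact h
  calc ∑ y, (∑ p, V y p * F p) ^ 2 ≤ ∑ y, ((∑ p, V y p) * ∑ p, V y p * F p ^ 2) :=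
        Finset.sum_le_sum fun y _ => hcs y
    _ = R * ∑ p, (∑ y, V y p) * F p ^ 2 := by
        simp_rw [hrow, ← Finset.mul_sum]
        congr 1
        rw [Finset.sum_comm]
        exact Finset.sum_congr rfl fun p _ => (Finset.sum_mul _ _ _).symm
    _ ≤ R * ∑ p, B * F p ^ 2 :=
        mul_le_mul_of_nonneg_left (Finset.sum_le_sum fun p _ =>
          mul_le_mul_of_nonneg_right (hcol p) (sq_nonneg _)) hR
    _ = R * B * ∑ p, F p ^ 2 := by rw [← Finset.mul_sum]; ring

/-- ★ **THE ENERGY INEQUALITY, EVERY `d`** (standing range `s ≤ m + K`): for every one-form `a` on the finest lattice and every plane `(μ, ν)`,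
`Σ_{y} curl(linAvgIter s a)(y;μ,ν)² ≤ (L²)^s·(L²/L^d)^s·Σ_p curl a(p;μ,ν)²` — Schur test on the (0.4) weight (`exists_weight`: `V ≥ 0`, row sums `(L²)^s`,
column sums `≤ (L²/L^d)^s`). [cite: Balaban1987RG1, (0.4)+(0.11) p.253; Balaban1985Averaging, (14) p.19] -/
theorem energy_curl_linAvgIter_le {s : ℕ} (hs : s ≤ P.m + P.K) (μ ν : Fin P.d) (a : PBond P 0 → ℝ) :
    ∑ y : Site P s, curlAt (linAvgIter s a) y μ ν ^ 2 ≤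
      (((P.L : ℝ) ^ 2) ^ s * (((P.L : ℝ) ^ 2 / (P.L : ℝ) ^ P.d) ^ s)) * ∑ p : Site P 0, curlAt a p μ ν ^ 2 := by
  obtain ⟨V, hV0, hrow, hcol, hrep⟩ := exists_weight μ ν s hs
  simp_rw [hrep a]
  exact sum_sq_kernel_le V (fun p => curlAt a p μ ν) (by positivity) hV0 hrow hcol

/-- In `d = 3` the factor is `L^s` (`= β_K/β_{K−s}`, [Balaban1985UV3] (1)–(3): `β_k = L^k/γ`). [cite: Balaban1985UV3, (1)-(3) p.256] -/
theorem factor_T3 (hd : P.d = 3) (hL : 0 < P.L) (s : ℕ) :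
    ((P.L : ℝ) ^ 2) ^ s * (((P.L : ℝ) ^ 2 / (P.L : ℝ) ^ P.d) ^ s) = (P.L : ℝ) ^ s := by
  have hL0 : (P.L : ℝ) ≠ 0 := by exact_mod_cast hL.ne'
  rw [hd, ← mul_pow]
  congr 1
  field_simp

/-- ★ **THE MAXWELL ACTIONS ALONG A RUN, d = 3**: `β·Σ_y curl(Q^s a)(y)² ≤ (β·L^s)·Σ_p curl a(p)²` for every `β ≥ 0` — the coarse lattice-Maxwell action of the
`s`-fold averaged field at the coarse coupling `β = β_{K−s}` is at most the fine action at the fine coupling `β_K = L^s β_{K−s}`. [cite: Balaban1985UV3, (1)-(3) p.256] -/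
theorem maxwell_linAvgIter_le_T3 (hd : P.d = 3) (hL : 0 < P.L) {s : ℕ} (hs : s ≤ P.m + P.K) (μ ν : Fin P.d) {β : ℝ} (hβ : 0 ≤ β)
    (a : PBond P 0 → ℝ) :
    β * ∑ y : Site P s, curlAt (linAvgIter s a) y μ ν ^ 2 ≤ (β * (P.L : ℝ) ^ s) * ∑ p : Site P 0, curlAt a p μ ν ^ 2 := by
  have h := energy_curl_linAvgIter_le hs μ ν a
  rw [factor_T3 hd hL s] at h
  calc β * ∑ y : Site P s, curlAt (linAvgIter s a) y μ ν ^ 2 ≤ β * ((P.L : ℝ) ^ s * ∑ p : Site P 0, curlAt a p μ ν ^ 2) :=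
        mul_le_mul_of_nonneg_left h hβ
    _ = (β * (P.L : ℝ) ^ s) * ∑ p : Site P 0, curlAt a p μ ν ^ 2 := by ring

/-- The same summed over all (ordered) planes: the full lattice-Maxwell actions. [cite: Balaban1985UV3, (1)-(3) p.256] -/
theorem maxwellAll_linAvgIter_le_T3 (hd : P.d = 3) (hL : 0 < P.L) {s : ℕ} (hs : s ≤ P.m + P.K) {β : ℝ} (hβ : 0 ≤ β) (a : PBond P 0 → ℝ) :
    β * ∑ y : Site P s, ∑ μ : Fin P.d, ∑ ν : Fin P.d, curlAt (linAvgIter s a) y μ ν ^ 2 ≤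
      (β * (P.L : ℝ) ^ s) * ∑ p : Site P 0, ∑ μ : Fin P.d, ∑ ν : Fin P.d, curlAt a p μ ν ^ 2 := by
  have hswap : ∀ (X : Type) [Fintype X] (f : X → Fin P.d → Fin P.d → ℝ),
      ∑ x : X, ∑ μ, ∑ ν, f x μ ν = ∑ μ, ∑ ν, ∑ x : X, f x μ ν := by
    intro X _ f
    rw [Finset.sum_comm]
    exact Finset.sum_congr rfl fun μ _ => Finset.sum_comm
  rw [hswap, hswap, Finset.mul_sum, Finset.mul_sum]
  refine Finset.sum_le_sum fun μ _ => ?_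
  rw [Finset.mul_sum, Finset.mul_sum]
  exact Finset.sum_le_sum fun ν _ => maxwell_linAvgIter_le_T3 hd hL hs μ ν hβ a

/-! ## §2 Large-deviation costs and dual variances are monotone under adding ultraviolet levels -/

/-- **ABSTRACT TRANSFER**: if `E₁ (Q x) ≤ E₂ x` for all `x`, then every upper bound `M` of `2g − E₁` is an upper bound of `2(g ∘ Q) − E₂`, for ANY `g`.
(For positive quadratic `E` and linear `g`, `sup (2g − E)` is the variance of `g` under the Gaussian `∝ e^{−E/2}`; for general `g` it is a Laplace value.) [folklore] -/
theorem dual_transfer {V₁ V₂ : Type*} (Q : V₂ → V₁) (E₁ : V₁ → ℝ) (E₂ : V₂ → ℝ) (hE : ∀ x, E₁ (Q x) ≤ E₂ x) (g : V₁ → ℝ) {M : ℝ}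
    (hM : ∀ b, 2 * g b - E₁ b ≤ M) (x : V₂) : 2 * g (Q x) - E₂ x ≤ M :=
  (sub_le_sub_left (hE x) _).trans (hM (Q x))

/-- **ABSTRACT TRANSFER, LARGE-DEVIATION FORM**: if `E₁ (Q x) ≤ E₂ x` for all `x`, a lower bound of `E₁` on a set `𝒜` is a lower bound of `E₂` on `Q⁻¹𝒜`. [folklore] -/
theorem ldCost_transfer {V₁ V₂ : Type*} (Q : V₂ → V₁) (E₁ : V₁ → ℝ) (E₂ : V₂ → ℝ) (hE : ∀ x, E₁ (Q x) ≤ E₂ x) (𝒜 : Set V₁) {M : ℝ}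
    (hM : ∀ b ∈ 𝒜, M ≤ E₁ b) (x : V₂) (hx : Q x ∈ 𝒜) : M ≤ E₂ x :=
  (hM (Q x) hx).trans (hE x)

/-- ★★ **LARGE-DEVIATION COSTS ARE MONOTONE UNDER ADDING UV LEVELS (d = 3, lattice-Maxwell caricature)**: for every set `𝒜` of level-`s` one-forms («a coarse
event», e.g. «this unit plaquette is `θ`-large»), if its coarse Maxwell cost is `≥ M` (`β·Σ(curl b)² ≥ M` on `𝒜`), then its cost in the theory with `s` more
ultraviolet levels is `≥ M` too (`(βL^s)·Σ(curl a)² ≥ M` whenever `linAvgIter s a ∈ 𝒜`).  In particular the Laplace asymptotics of every coarse tail event can only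
IMPROVE as levels are added — the sign behind `CondStab` (`ρ ≤ 0` in the caricature). [cite: Balaban1987RG1, (0.4)+(0.11) p.253; Balaban1985UV3, (1)-(3) p.256] -/
theorem ldCost_mono_T3 (hd : P.d = 3) (hL : 0 < P.L) {s : ℕ} (hs : s ≤ P.m + P.K) {β : ℝ} (hβ : 0 ≤ β)
    (𝒜 : Set (PBond P s → ℝ)) {M : ℝ}
    (hM : ∀ b ∈ 𝒜, M ≤ β * ∑ y : Site P s, ∑ μ : Fin P.d, ∑ ν : Fin P.d, curlAt b y μ ν ^ 2)
    (a : PBond P 0 → ℝ) (ha : linAvgIter s a ∈ 𝒜) :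
    M ≤ (β * (P.L : ℝ) ^ s) * ∑ p : Site P 0, ∑ μ : Fin P.d, ∑ ν : Fin P.d, curlAt a p μ ν ^ 2 :=
  ldCost_transfer (linAvgIter s) (fun b => β * ∑ y : Site P s, ∑ μ : Fin P.d, ∑ ν : Fin P.d, curlAt b y μ ν ^ 2)
    (fun a => (β * (P.L : ℝ) ^ s) * ∑ p : Site P 0, ∑ μ : Fin P.d, ∑ ν : Fin P.d, curlAt a p μ ν ^ 2)
    (fun a => maxwellAll_linAvgIter_le_T3 hd hL hs hβ a) 𝒜 hM a ha

/-- ★★ **DUAL VARIANCES ARE MONOTONE UNDER ADDING UV LEVELS (d = 3, lattice-Maxwell caricature)**: for EVERY functional `g` of the level-`s` field,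
`sup_a [2·g(linAvgIter s a) − (βL^s)·Σ(curl a)²] ≤ sup_b [2·g(b) − β·Σ(curl b)²]` (stated bound-wise).  For gauge-invariant linear `g` both suprema are the variances of
`g` under the lattice-Maxwell laws `∝ exp(−½βΣcurl²)` of the two runs (fine run: `β_K = βL^s`, observable `g ∘ Q^s`; coarse run: `β_{K−s} = β`, observable `g`):
`Var_K(g ∘ Q^s) ≤ Var_{K−s}(g)` — the kit j291705 monotonicity (`0.2541 > 0.2153 > 0.2110 > 0.2105`) for every observable.
[cite: Balaban1987RG1, (0.4)+(0.11) p.253; Balaban1985UV3, (1)-(3) p.256] -/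
theorem dualVariance_mono_T3 (hd : P.d = 3) (hL : 0 < P.L) {s : ℕ} (hs : s ≤ P.m + P.K) {β : ℝ} (hβ : 0 ≤ β)
    (g : (PBond P s → ℝ) → ℝ) {M : ℝ}
    (hM : ∀ b : PBond P s → ℝ, 2 * g b - β * ∑ y : Site P s, ∑ μ : Fin P.d, ∑ ν : Fin P.d, curlAt b y μ ν ^ 2 ≤ M)
    (a : PBond P 0 → ℝ) :
    2 * g (linAvgIter s a) - (β * (P.L : ℝ) ^ s) * ∑ p : Site P 0, ∑ μ : Fin P.d, ∑ ν : Fin P.d, curlAt a p μ ν ^ 2 ≤ M :=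
  dual_transfer (linAvgIter s) (fun b => β * ∑ y : Site P s, ∑ μ : Fin P.d, ∑ ν : Fin P.d, curlAt b y μ ν ^ 2)
    (fun a => (β * (P.L : ℝ) ^ s) * ∑ p : Site P 0, ∑ μ : Fin P.d, ∑ ν : Fin P.d, curlAt a p μ ν ^ 2)
    (fun a => maxwellAll_linAvgIter_le_T3 hd hL hs hβ a) g hM a

/-- **ONE STEP** (`s = 1`: the caricature of `CondStab`'s `K ↦ K+1`; the extra level is the finest one, `g` is an arbitrary functional of the once-averaged field,
e.g. «`K` further averagings, then the unit plaquette»): `sup_a [2g(linAvg04 a) − (βL)Σ(curl a)²] ≤ sup_b [2g(b) − βΣ(curl b)²]`. [cite: Balaban1987RG1, (0.4) p.253] -/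
theorem dualVariance_mono_T3_one (hd : P.d = 3) (hL : 0 < P.L) (h1 : 1 ≤ P.m + P.K) {β : ℝ} (hβ : 0 ≤ β)
    (g : (PBond P 1 → ℝ) → ℝ) {M : ℝ}
    (hM : ∀ b : PBond P 1 → ℝ, 2 * g b - β * ∑ y : Site P 1, ∑ μ : Fin P.d, ∑ ν : Fin P.d, curlAt b y μ ν ^ 2 ≤ M)
    (a : PBond P 0 → ℝ) :
    2 * g (linAvg04 a) - (β * (P.L : ℝ)) * ∑ p : Site P 0, ∑ μ : Fin P.d, ∑ ν : Fin P.d, curlAt a p μ ν ^ 2 ≤ M := by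
  have h := dualVariance_mono_T3 hd hL h1 hβ g hM a
  simpa [linAvgIter, pow_one] using h

/-- **ONE STEP, LARGE-DEVIATION FORM** (`s = 1`). [cite: Balaban1987RG1, (0.4) p.253] -/
theorem ldCost_mono_T3_one (hd : P.d = 3) (hL : 0 < P.L) (h1 : 1 ≤ P.m + P.K) {β : ℝ} (hβ : 0 ≤ β)
    (𝒜 : Set (PBond P 1 → ℝ)) {M : ℝ}
    (hM : ∀ b ∈ 𝒜, M ≤ β * ∑ y : Site P 1, ∑ μ : Fin P.d, ∑ ν : Fin P.d, curlAt b y μ ν ^ 2)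
    (a : PBond P 0 → ℝ) (ha : linAvg04 a ∈ 𝒜) :
    M ≤ (β * (P.L : ℝ)) * ∑ p : Site P 0, ∑ μ : Fin P.d, ∑ ν : Fin P.d, curlAt a p μ ν ^ 2 := by
  have h := ldCost_mono_T3 hd hL h1 hβ 𝒜 hM a (by simpa [linAvgIter] using ha)
  simpa [pow_one] using h

end Summit.QuantumFields.YangMills.Theorems.LargeFieldMassRefinementTailCondStabMaxwellRung

end
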